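import Summits.Ventures.PercRepro.RankLevelSetFrameLarge
import Summits.Ventures.PercRepro.RankLevelSet

/-!
# PercRepro — THEOREM C∞ restated: at every level the exceptional ranks form a FINITE set (night-1, gen 3)

`proofs/NIGHT-1-C025-induction.md` §14. `exists_P_c025_all_corank` says: at level `q ≥ 2`, C-025 holds for every
finite matroid once `p ≥ P(q)`; below `q + 2` it holds trivially (`Φ = 0`, `RLS_of_le`). Hence:

* **`c025_exceptional_finite`** — for every `q ≥ 2`, the set of ranks `p` at which the rank level-set inequality at
  level `q` fails for SOME finite matroid is finite (it lies in `p < P(q)`);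
* **`c025_eventually`** — the `Filter.atTop` form: `∀ᶠ p in atTop, ∀ M, RLS M p q`;
* **`C025LargeRank`**, **`C025LargeRank_holds`** — the row `C025` (`RankLevelSet.lean`) weakened to «every level
  `q ≥ 2` beyond a threshold in `p`», and the theorem that it holds (the Conjectures-file bridge of Theorem C∞).
The residue of the crux at a fixed level is thus the finite window `q + 2 ≤ p < P(q)`, each member a statement about
matroids of every size. Axioms: standard.
-/

open scoped Matroid

namespace PercRepro

namespace ThmN

/-- **The exceptional ranks at level `q` form a finite set**: for `q ≥ 2`,
`{p | ∃ M finite, Φ(p, q)·#U(p, q) > #Y(p, q)}` is finite. -/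
theorem c025_exceptional_finite (q : ℕ) (hq : 2 ≤ q) :
    {p : ℕ | ¬ ∀ {α : Type} (M : Matroid α) [M.Finite], RLS M p q}.Finite := by
  obtain ⟨P, hP⟩ := exists_P_c025_all_corank q hq
  refine (Set.finite_Iio P).subset ?_
  intro p hp
  rw [Set.mem_setOf_eq] at hp
  rw [Set.mem_Iio]
  by_contra hlt
  push Not at hlt
  apply hp
  intro α M _
  rcases Nat.lt_or_ge p (q + 2) with h | h
  · exact RLS_of_le M (by omega)
  · exact hP M p hlt h

/-- **Eventually in `p`**: for `q ≥ 2`, `∀ᶠ p in atTop, ∀ M, RLS M p q`. -/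
theorem c025_eventually (q : ℕ) (hq : 2 ≤ q) :
    ∀ᶠ p in Filter.atTop, ∀ {α : Type} (M : Matroid α) [M.Finite], RLS M p q := by
  obtain ⟨P, hP⟩ := exists_P_c025_all_corank q hq
  rw [Filter.eventually_atTop]
  refine ⟨max P (q + 2), fun p hp α M _ => hP M p (le_trans (le_max_left _ _) hp) (le_trans (le_max_right _ _) hp)⟩

end ThmN

/-- **C-025 AT LARGE RANK**: the row `C025` weakened to «for every level `q ≥ 2` there is a threshold `P` beyond
which every finite matroid satisfies the inequality at `(p, q)`». -/
def C025LargeRank : Prop :=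
  ∀ q : ℕ, 2 ≤ q → ∃ P : ℕ, ∀ {α : Type} (M : Matroid α) [M.Finite] (p : ℕ), P ≤ p →
    phiK p q * ({A : Set α | A ⊆ M.E ∧ M.eRk A = (p : ℕ∞) ∧ M.eRk (M.E \ A) = (q : ℕ∞)}.ncard : ℚ) ≤
      ({A : Set α | A ⊆ M.E ∧ (q : ℕ∞) < M.eRk A ∧ M.eRk A < (p : ℕ∞)}.ncard : ℚ)

/-- The row `C025` implies its large-rank weakening. -/
theorem C025LargeRank_of_C025 (h : C025) : C025LargeRank :=
  fun q _ => ⟨q + 2, fun M _ p hp => h M p q hp⟩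

/-- **THEOREM C∞ as a row statement**: `C025LargeRank` holds. -/
theorem C025LargeRank_holds : C025LargeRank :=
  fun q hq => ThmN.c025_all_corank_of_large_rank q hq

end PercRepro
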